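import Summits.QuantumFields.YangMills.Theorems.AlphaInputsT3ACv3EMLIterFirstOrderUniform
import Summits.QuantumFields.YangMills.Theorems.AlphaInputsT3ACv3LinAvgIterFluxRigid
import HarnessLib

/-!
# `AlphaInputsT3ACv3EMLIterPlaqFirstOrder` — (69)_sym AT THE FLAT GAUGE: the plaquette of the symmetric `s`-fold (0.4) average of a globally `δ`-small configuration is
# `1 +` print's RIGID first-order sum `+ O(m_s²)`, `k`-UNIFORMLY — `dist1((blockAvg ℰ)^s U)(∂p′) ≤ L^{−sd}·Σ_{x∈B^s(y)}Σ_{a,b<L^s} dist1 U(∂□₁(x + ae_μ + be_ν)) + C·m_s²`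
# — cell `ym3-torus`, width seat 19936-w6 (g2); (α)-seam memo `ym-ust-19936-w6/LOCATE-alpha-seam-w6-g2.md` §2 pieces (iii) + (i)∘(ii)-flat

WHY.  ★★OWNER RULING g26-№13 (ii): the seam row of record for B1 becomes (71)_sym per recorded plaquette, supplied from (69)_sym = the two-sided rigid first order of the
symmetric `j`-fold average + ✓`B10Eq70Squaring.ineq70_d3`.  The tree holds the `k`-uniform BOND-level first order at the flat gauge
(✓`EMLIterUniform.norm_iter_sub_one_sub_iterLin_le_uniform`: `‖Ū^{(s)}(c) − 1 − Q^{(s)}Y(c)‖ ≤ 324L(d+2)²m_s²`, `‖Ū^{(s)}(c) − 1‖ ≤ 2m_s`) and, since p614177,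
the rigid circulation of `Q^{(s)}` (✓`LinAvgIterFluxRigid.curl_iterLinAvg_eq_rigidFlux`).  THIS FILE assembles the PLAQUETTE: §1 the normed-algebra letter «a product
`ABC*D*` of four unitaries within `t ≤ 1` of `1` is `1 + (a + b − c − d) + O(13t²)`»; §2 the plaquette of `Ū^{(s)}` is `1 + curl(Q^{(s)}Y) + O(m_s²)`; §3 with piece (i) and the
fine-plaquette reading `‖curl Y(q)‖ ≤ dist1 U(q) + 13δ²`: ★★ `dist1_plaqHol_iter_le_rigidSum` — (69)_sym for globally `δ`-small `U` (flat gauge), constants `k`-uniform.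
What is NOT here (memo §2 (ii), (iv)): the box axial gauge + clamp that produce a globally `δ`-small representative from print's (68) on `Δ′`, and the torus → ℤ³
`blockSum` letters of `ineq70_d3`.

HONEST FRAMING.  Kernel bookkeeping over tree theorems at the flat gauge; nothing of Bałaban's is asserted beyond what is proved; the class of record and the registry are
untouched (J r4).  Count-neutral helper toward R3 2′∕2′χ (`stub_laneRecordsV3Chi`, item 19936 — NOT proved here); YM₃ on T³ = rung R3 (finite-torus SU(2)), not T⁴, not the
continuum limit, not the Clay problem; no mass gap is claimed.

References: T. Bałaban, Commun. Math. Phys. 98 (1985) 17–51 [Balaban1985Averaging] ((9) p.19, (19)–(20) p.21, Prop. 4 (134)–(135) p.38); CMP 102 (1985) 255–275 [Balaban1985UV3] ((69) p.273).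
-/

set_option autoImplicit false

noncomputable section

open scoped BigOperators Matrix.Norms.L2Operator

namespace Summit.QuantumFields.YangMills.Theorems.EMLIterPlaqFirstOrder

open Finset
open Literature.MathematicalPhysics.QuantumFieldTheory.Balaban1983to89
open T4Continuum BlockAveraging ExpMeanLog BlockAveragingEMLLinearised LatticeFieldCalculus
open Literature.MathematicalPhysics.QuantumLattice (coe_inv_eq_star)
open Summit.QuantumFields.YangMills.Theorems.EMLIterUniform (norm_iter_sub_one_sub_iterLin_le_uniform main_scale_mono)
open Summit.QuantumFields.YangMills.Theorems.Prop7HolRatioPerStep (coe_star_mul_self)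
open Summit.QuantumFields.YangMills.Theorems.LinAvgIterFluxRigid (curl_iterLinAvg_eq_rigidFlux)

/-! ## §1 Four near-identity unitaries -/

section Algebra

variable {𝔸 : Type*} [NormedRing 𝔸] [StarRing 𝔸] [NormedStarGroup 𝔸]

/-- For `C` with `C*C = 1` and `‖C − 1‖ ≤ t`: `‖(C* − 1) + (C − 1)‖ ≤ t²` (`(C* − 1) + (C − 1) = −(C* − 1)(C − 1)`). [folklore] -/
theorem norm_star_sub_one_add_sub_one_le {C : 𝔸} (hC : star C * C = 1) {t : ℝ} (ht : ‖C - 1‖ ≤ t) :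
    ‖(star C - 1) + (C - 1)‖ ≤ t ^ 2 := by
  have hid : (star C - 1) + (C - 1) = -((star C - 1) * (C - 1)) := by
    have : (star C - 1) * (C - 1) = star C * C - star C - C + 1 := by noncomm_ring
    rw [this, hC]; noncomm_ring
  rw [hid, norm_neg]
  refine (norm_mul_le _ _).trans ?_
  have hs : ‖star C - 1‖ = ‖C - 1‖ := by rw [← norm_star (C - 1), star_sub, star_one]
  rw [hs, sq]
  exact mul_le_mul ht ht (norm_nonneg _) ((norm_nonneg _).trans ht)

/-- **★ FOUR NEAR-IDENTITY UNITARIES**: if `C*C = D*D = 1` and `A, B, C, D` are within `t ≤ 1` of `1`, then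
`‖A·B·C*·D* − 1 − ((A−1) + (B−1) − (C−1) − (D−1))‖ ≤ 13t²` (the eleven cross products `≤ 11t²`, the two conjugation defects `≤ t²` each). [cite: Balaban1985Averaging, (9) p.19, (19) p.21] -/
theorem norm_prod4_star_sub_one_sub_lin_le {A B C D : 𝔸} (hC : star C * C = 1) (hD : star D * D = 1) {t : ℝ} (ht0 : 0 ≤ t) (ht1 : t ≤ 1)
    (hA : ‖A - 1‖ ≤ t) (hB : ‖B - 1‖ ≤ t) (hCt : ‖C - 1‖ ≤ t) (hDt : ‖D - 1‖ ≤ t) :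
    ‖A * B * star C * star D - 1 - ((A - 1) + (B - 1) - (C - 1) - (D - 1))‖ ≤ 13 * t ^ 2 := by
  set a := A - 1 with ha
  set b := B - 1 with hb
  set c' := star C - 1 with hc'
  set d' := star D - 1 with hd'
  have hAc : A = 1 + a := by rw [ha]; abel
  have hBc : B = 1 + b := by rw [hb]; abel
  have hCc : star C = 1 + c' := by rw [hc']; abel
  have hDc : star D = 1 + d' := by rw [hd']; abel
  have hc'n : ‖c'‖ ≤ t := by rw [hc', ← norm_star (C - 1), star_sub, star_one] at *; exact hCt
  have hd'n : ‖d'‖ ≤ t := by rw [hd', ← norm_star (D - 1), star_sub, star_one] at *; exact hDt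
  -- the expansion
  have hexp : A * B * star C * star D - 1 - (a + b + c' + d') =
      a * b + a * c' + a * d' + b * c' + b * d' + c' * d' + a * b * c' + a * b * d' + a * c' * d' + b * c' * d' + a * b * c' * d' := by
    rw [hAc, hBc, hCc, hDc]; noncomm_ring
  -- linear part versus `a + b − c − d`
  have hlin : (a + b + c' + d') - (a + b - (C - 1) - (D - 1)) = (c' + (C - 1)) + (d' + (D - 1)) := by abel
  have h2 : ∀ x y : 𝔸, ‖x‖ ≤ t → ‖y‖ ≤ t → ‖x * y‖ ≤ t ^ 2 := fun x y hx hy =>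
    (norm_mul_le _ _).trans (by rw [sq]; exact mul_le_mul hx hy (norm_nonneg _) ht0)
  have h3 : ∀ x y z : 𝔸, ‖x‖ ≤ t → ‖y‖ ≤ t → ‖z‖ ≤ t → ‖x * y * z‖ ≤ t ^ 2 := fun x y z hx hy hz => by
    refine (norm_mul_le _ _).trans ?_
    have := h2 x y hx hy
    calc ‖x * y‖ * ‖z‖ ≤ t ^ 2 * t := mul_le_mul this hz (norm_nonneg _) (by positivity)
      _ ≤ t ^ 2 * 1 := by gcongr
      _ = t ^ 2 := mul_one _
  have h4 : ‖a * b * c' * d'‖ ≤ t ^ 2 := by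
    refine (norm_mul_le _ _).trans ?_
    calc ‖a * b * c'‖ * ‖d'‖ ≤ t ^ 2 * t := mul_le_mul (h3 a b c' hA hB hc'n) hd'n (norm_nonneg _) (by positivity)
      _ ≤ t ^ 2 * 1 := by gcongr
      _ = t ^ 2 := mul_one _
  have hcross : ‖A * B * star C * star D - 1 - (a + b + c' + d')‖ ≤ 11 * t ^ 2 := by
    rw [hexp]
    have e1 := h2 a b hA hB; have e2 := h2 a c' hA hc'n; have e3 := h2 a d' hA hd'n
    have e4 := h2 b c' hB hc'n; have e5 := h2 b d' hB hd'n; have e6 := h2 c' d' hc'n hd'n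
    have e7 := h3 a b c' hA hB hc'n; have e8 := h3 a b d' hA hB hd'n; have e9 := h3 a c' d' hA hc'n hd'n
    have e10 := h3 b c' d' hB hc'n hd'n
    calc _ ≤ ‖a * b + a * c' + a * d' + b * c' + b * d' + c' * d' + a * b * c' + a * b * d' + a * c' * d' + b * c' * d'‖ + ‖a * b * c' * d'‖ := norm_add_le _ _
      _ ≤ (‖a * b + a * c' + a * d' + b * c' + b * d' + c' * d' + a * b * c' + a * b * d' + a * c' * d'‖ + ‖b * c' * d'‖) + ‖a * b * c' * d'‖ := by
          gcongr; exact norm_add_le _ _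
      _ ≤ ((‖a * b + a * c' + a * d' + b * c' + b * d' + c' * d' + a * b * c' + a * b * d'‖ + ‖a * c' * d'‖) + ‖b * c' * d'‖) + ‖a * b * c' * d'‖ := by
          gcongr; exact norm_add_le _ _
      _ ≤ (((‖a * b + a * c' + a * d' + b * c' + b * d' + c' * d' + a * b * c'‖ + ‖a * b * d'‖) + ‖a * c' * d'‖) + ‖b * c' * d'‖) + ‖a * b * c' * d'‖ := by
          gcongr; exact norm_add_le _ _
      _ ≤ ((((‖a * b + a * c' + a * d' + b * c' + b * d' + c' * d'‖ + ‖a * b * c'‖) + ‖a * b * d'‖) + ‖a * c' * d'‖) + ‖b * c' * d'‖) + ‖a * b * c' * d'‖ := by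
          gcongr; exact norm_add_le _ _
      _ ≤ (((((‖a * b + a * c' + a * d' + b * c' + b * d'‖ + ‖c' * d'‖) + ‖a * b * c'‖) + ‖a * b * d'‖) + ‖a * c' * d'‖) + ‖b * c' * d'‖) + ‖a * b * c' * d'‖ := by
          gcongr; exact norm_add_le _ _
      _ ≤ ((((((‖a * b + a * c' + a * d' + b * c'‖ + ‖b * d'‖) + ‖c' * d'‖) + ‖a * b * c'‖) + ‖a * b * d'‖) + ‖a * c' * d'‖) + ‖b * c' * d'‖) + ‖a * b * c' * d'‖ := by
          gcongr; exact norm_add_le _ _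
      _ ≤ (((((((‖a * b + a * c' + a * d'‖ + ‖b * c'‖) + ‖b * d'‖) + ‖c' * d'‖) + ‖a * b * c'‖) + ‖a * b * d'‖) + ‖a * c' * d'‖) + ‖b * c' * d'‖) + ‖a * b * c' * d'‖ := by
          gcongr; exact norm_add_le _ _
      _ ≤ ((((((((‖a * b + a * c'‖ + ‖a * d'‖) + ‖b * c'‖) + ‖b * d'‖) + ‖c' * d'‖) + ‖a * b * c'‖) + ‖a * b * d'‖) + ‖a * c' * d'‖) + ‖b * c' * d'‖) + ‖a * b * c' * d'‖ := by
          gcongr; exact norm_add_le _ _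
      _ ≤ (((((((((‖a * b‖ + ‖a * c'‖) + ‖a * d'‖) + ‖b * c'‖) + ‖b * d'‖) + ‖c' * d'‖) + ‖a * b * c'‖) + ‖a * b * d'‖) + ‖a * c' * d'‖) + ‖b * c' * d'‖) + ‖a * b * c' * d'‖ := by
          gcongr; exact norm_add_le _ _
      _ ≤ (((((((((t ^ 2 + t ^ 2) + t ^ 2) + t ^ 2) + t ^ 2) + t ^ 2) + t ^ 2) + t ^ 2) + t ^ 2) + t ^ 2) + t ^ 2 := by
          gcongr
      _ = 11 * t ^ 2 := by ring
  have hcc : ‖c' + (C - 1)‖ ≤ t ^ 2 := norm_star_sub_one_add_sub_one_le hC hCt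
  have hdd : ‖d' + (D - 1)‖ ≤ t ^ 2 := norm_star_sub_one_add_sub_one_le hD hDt
  have hsplit : A * B * star C * star D - 1 - (a + b - (C - 1) - (D - 1)) =
      (A * B * star C * star D - 1 - (a + b + c' + d')) + ((c' + (C - 1)) + (d' + (D - 1))) := by abel
  rw [hsplit]
  calc _ ≤ ‖A * B * star C * star D - 1 - (a + b + c' + d')‖ + ‖(c' + (C - 1)) + (d' + (D - 1))‖ := norm_add_le _ _
    _ ≤ 11 * t ^ 2 + (t ^ 2 + t ^ 2) := by gcongr; exact (norm_add_le _ _).trans (add_le_add hcc hdd)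
    _ = 13 * t ^ 2 := by ring

end Algebra

/-! ## §2 The plaquette of the `s`-fold average: first order = the circulation of `Q^{(s)}Y` -/

section Torus

variable {P : Params} {n : Type*} [Fintype n] [DecidableEq n] [Nonempty n]

/-- The plaquette holonomy of an `SU(n)` field read in `M_n(ℂ)`: `U₁·U₂·U₃*·U₄*`. [cite: Balaban1985Averaging, (9) p.19] -/
theorem coe_plaqHol_eq {j : ℕ} (V : GaugeField P j (Matrix.specialUnitaryGroup n ℂ)) (p : Plaq P j) :
    ((GaugeField.plaqHol V p : Matrix.specialUnitaryGroup n ℂ) : Matrix n n ℂ) =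
      (V ⟨p.src, p.μ⟩ : Matrix n n ℂ) * (V ⟨p.src.shift p.μ, p.ν⟩ : Matrix n n ℂ) * star (V ⟨p.src.shift p.ν, p.μ⟩ : Matrix n n ℂ) *
        star (V ⟨p.src, p.ν⟩ : Matrix n n ℂ) := by
  simp only [GaugeField.plaqHol, Submonoid.coe_mul, coe_inv_eq_star]

/-- **★ THE PLAQUETTE OF `Ū^{(s)}` TO FIRST ORDER**: for a finest-lattice `SU(n)` configuration `U` with `‖U_b − 1‖ ≤ δ` everywhere, under the window of
`EMLIterUniform.norm_iter_sub_one_sub_iterLin_le_uniform` (and `2m_k ≤ 1`), for every `s ≤ k` and every plaquette `p` of `T^{(s)}`: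
`‖Ū^{(s)}(∂p) − 1 − curl(Q^{(s)}Y)(p)‖ ≤ 4·324L(d+2)²m_s² + 52m_s²` (`Y = U − 1`, `m_s = 2|n|²(d+1)L^sδ`; `curl` = the signed sum of `Q^{(s)}Y` over `∂p`).
[cite: Balaban1985Averaging, Prop. 4 (134)–(135) p.38, (9) p.19] -/
theorem norm_plaqHol_iter_sub_one_sub_curl_le
    (Q : (i : ℕ) → (PBond P 0 → Matrix n n ℂ) → PBond P i → Matrix n n ℂ)
    (hQ0 : ∀ Y, Q 0 Y = Y) (hQs : ∀ (i : ℕ) (Y : PBond P 0 → Matrix n n ℂ) (c : PBond P (i + 1)), Q (i + 1) Y c = linAvg (Q i Y) c)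
    (hL : P.d + 2 ≤ P.L) (U : GaugeField P 0 (Matrix.specialUnitaryGroup n ℂ)) {δ : ℝ} (hδ : 0 ≤ δ)
    (hU : ∀ b, ‖((U b : Matrix.specialUnitaryGroup n ℂ) : Matrix n n ℂ) - 1‖ ≤ δ) (k : ℕ)
    (hm : 324 * (P.L : ℝ) * ((P.d : ℝ) + 2) ^ 2 * (2 * (Fintype.card n : ℝ) ^ 2 * (((P.d : ℝ) + 1) * (P.L : ℝ) ^ k * δ)) ≤ 1)
    (hN : 4 * (((P.d + 2) * P.L : ℕ) : ℝ) * (2 * (Fintype.card n : ℝ) ^ 2 * (((P.d : ℝ) + 1) * (P.L : ℝ) ^ k * δ)) < deltaSU n)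
    (hm1 : 2 * (2 * (Fintype.card n : ℝ) ^ 2 * (((P.d : ℝ) + 1) * (P.L : ℝ) ^ k * δ)) ≤ 1)
    {s : ℕ} (hs : s ≤ k) (p : Plaq P s) :
    ‖((GaugeField.plaqHol (Averaging.iter (fun i => blockAvg (P := P) (j := i) (expMeanLogSU (n := n))) s U) p : Matrix.specialUnitaryGroup n ℂ) : Matrix n n ℂ)
        - 1 - (Q s (fun b => ((U b : Matrix.specialUnitaryGroup n ℂ) : Matrix n n ℂ) - 1) ⟨p.src, p.μ⟩
              + Q s (fun b => ((U b : Matrix.specialUnitaryGroup n ℂ) : Matrix n n ℂ) - 1) ⟨p.src.shift p.μ, p.ν⟩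
              - Q s (fun b => ((U b : Matrix.specialUnitaryGroup n ℂ) : Matrix n n ℂ) - 1) ⟨p.src.shift p.ν, p.μ⟩
              - Q s (fun b => ((U b : Matrix.specialUnitaryGroup n ℂ) : Matrix n n ℂ) - 1) ⟨p.src, p.ν⟩)‖ ≤
      4 * (324 * (P.L : ℝ) * ((P.d : ℝ) + 2) ^ 2 * (2 * (Fintype.card n : ℝ) ^ 2 * (((P.d : ℝ) + 1) * (P.L : ℝ) ^ s * δ)) ^ 2) +
        52 * (2 * (Fintype.card n : ℝ) ^ 2 * (((P.d : ℝ) + 1) * (P.L : ℝ) ^ s * δ)) ^ 2 := by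
  -- letters
  set V := Averaging.iter (fun i => blockAvg (P := P) (j := i) (expMeanLogSU (n := n))) s U with hV
  set Y : PBond P 0 → Matrix n n ℂ := fun b => ((U b : Matrix.specialUnitaryGroup n ℂ) : Matrix n n ℂ) - 1 with hY
  set m : ℝ := 2 * (Fintype.card n : ℝ) ^ 2 * (((P.d : ℝ) + 1) * (P.L : ℝ) ^ s * δ) with hmdef
  set R : ℝ := 324 * (P.L : ℝ) * ((P.d : ℝ) + 2) ^ 2 * m ^ 2 with hRdef
  have hunif := norm_iter_sub_one_sub_iterLin_le_uniform Q hQ0 hQs hL U hδ hU k hm hN s hs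
  have hm0 : 0 ≤ m := by rw [hmdef]; positivity
  have hmk : m ≤ 2 * (Fintype.card n : ℝ) ^ 2 * (((P.d : ℝ) + 1) * (P.L : ℝ) ^ k * δ) := main_scale_mono hδ hs
  have ht1 : 2 * m ≤ 1 := (mul_le_mul_of_nonneg_left hmk (by norm_num)).trans hm1
  -- the four bonds
  set b₁ : PBond P s := ⟨p.src, p.μ⟩
  set b₂ : PBond P s := ⟨p.src.shift p.μ, p.ν⟩
  set b₃ : PBond P s := ⟨p.src.shift p.ν, p.μ⟩
  set b₄ : PBond P s := ⟨p.src, p.ν⟩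
  have hdev : ∀ b : PBond P s, ‖((V b : Matrix.specialUnitaryGroup n ℂ) : Matrix n n ℂ) - 1‖ ≤ 2 * m := fun b => (hunif b).1
  have hrem : ∀ b : PBond P s, ‖((V b : Matrix.specialUnitaryGroup n ℂ) : Matrix n n ℂ) - 1 - Q s Y b‖ ≤ R := fun b => (hunif b).2
  -- the algebra letter at `t := 2m`
  have halg := norm_prod4_star_sub_one_sub_lin_le (coe_star_mul_self (V b₃)) (coe_star_mul_self (V b₄)) (by positivity) ht1
    (hdev b₁) (hdev b₂) (hdev b₃) (hdev b₄)
  rw [coe_plaqHol_eq]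
  -- split: (plaq − 1 − lin(V−1)) + (lin(V−1) − lin(QY))
  have hsplit : (V b₁ : Matrix n n ℂ) * (V b₂ : Matrix n n ℂ) * star (V b₃ : Matrix n n ℂ) * star (V b₄ : Matrix n n ℂ) - 1
        - (Q s Y b₁ + Q s Y b₂ - Q s Y b₃ - Q s Y b₄) =
      ((V b₁ : Matrix n n ℂ) * (V b₂ : Matrix n n ℂ) * star (V b₃ : Matrix n n ℂ) * star (V b₄ : Matrix n n ℂ) - 1
        - (((V b₁ : Matrix n n ℂ) - 1) + ((V b₂ : Matrix n n ℂ) - 1) - ((V b₃ : Matrix n n ℂ) - 1) - ((V b₄ : Matrix n n ℂ) - 1))) +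
      ((((V b₁ : Matrix n n ℂ) - 1 - Q s Y b₁) + ((V b₂ : Matrix n n ℂ) - 1 - Q s Y b₂)) -
        (((V b₃ : Matrix n n ℂ) - 1 - Q s Y b₃) + ((V b₄ : Matrix n n ℂ) - 1 - Q s Y b₄))) := by abel
  rw [hsplit]
  refine (norm_add_le _ _).trans ?_
  have hsecond : ‖(((V b₁ : Matrix n n ℂ) - 1 - Q s Y b₁) + ((V b₂ : Matrix n n ℂ) - 1 - Q s Y b₂)) -
      (((V b₃ : Matrix n n ℂ) - 1 - Q s Y b₃) + ((V b₄ : Matrix n n ℂ) - 1 - Q s Y b₄))‖ ≤ 4 * R := by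
    calc _ ≤ ‖((V b₁ : Matrix n n ℂ) - 1 - Q s Y b₁) + ((V b₂ : Matrix n n ℂ) - 1 - Q s Y b₂)‖ +
          ‖((V b₃ : Matrix n n ℂ) - 1 - Q s Y b₃) + ((V b₄ : Matrix n n ℂ) - 1 - Q s Y b₄)‖ := norm_sub_le _ _
      _ ≤ (R + R) + (R + R) := add_le_add ((norm_add_le _ _).trans (add_le_add (hrem b₁) (hrem b₂)))
          ((norm_add_le _ _).trans (add_le_add (hrem b₃) (hrem b₄)))
      _ = 4 * R := by ring
  have h13 : 13 * (2 * m) ^ 2 = 52 * m ^ 2 := by ring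
  rw [h13] at halg
  linarith [halg, hsecond]

/-- **FINE PLAQUETTES**: for `‖U_b − 1‖ ≤ δ ≤ 1` on the four bonds, `‖curl(U − 1)(q)‖ ≤ dist1 U(∂q) + 13δ²`. [cite: Balaban1985Averaging, (9) p.19, (19) p.21] -/
theorem norm_curl_sub_le_dist1_add {j : ℕ} (U : GaugeField P j (Matrix.specialUnitaryGroup n ℂ)) {δ : ℝ} (hδ : 0 ≤ δ) (hδ1 : δ ≤ 1)
    (hU : ∀ b, ‖((U b : Matrix.specialUnitaryGroup n ℂ) : Matrix n n ℂ) - 1‖ ≤ δ) (q : Plaq P j) :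
    ‖(((U ⟨q.src, q.μ⟩ : Matrix.specialUnitaryGroup n ℂ) : Matrix n n ℂ) - 1) + (((U ⟨q.src.shift q.μ, q.ν⟩ : Matrix.specialUnitaryGroup n ℂ) : Matrix n n ℂ) - 1)
        - (((U ⟨q.src.shift q.ν, q.μ⟩ : Matrix.specialUnitaryGroup n ℂ) : Matrix n n ℂ) - 1) - (((U ⟨q.src, q.ν⟩ : Matrix.specialUnitaryGroup n ℂ) : Matrix n n ℂ) - 1)‖ ≤
      GaugeGroup.dist1 (GaugeField.plaqHol U q) + 13 * δ ^ 2 := by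
  have halg := norm_prod4_star_sub_one_sub_lin_le (coe_star_mul_self (U ⟨q.src.shift q.ν, q.μ⟩)) (coe_star_mul_self (U ⟨q.src, q.ν⟩)) hδ hδ1
    (hU ⟨q.src, q.μ⟩) (hU ⟨q.src.shift q.μ, q.ν⟩) (hU ⟨q.src.shift q.ν, q.μ⟩) (hU ⟨q.src, q.ν⟩)
  have hd : GaugeGroup.dist1 (GaugeField.plaqHol U q) = ‖((GaugeField.plaqHol U q : Matrix.specialUnitaryGroup n ℂ) : Matrix n n ℂ) - 1‖ := rfl
  rw [hd, coe_plaqHol_eq]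
  -- `lin = (plaq − 1) − (plaq − 1 − lin)`
  set W := ((U ⟨q.src, q.μ⟩ : Matrix.specialUnitaryGroup n ℂ) : Matrix n n ℂ) * ((U ⟨q.src.shift q.μ, q.ν⟩ : Matrix.specialUnitaryGroup n ℂ) : Matrix n n ℂ) *
      star ((U ⟨q.src.shift q.ν, q.μ⟩ : Matrix.specialUnitaryGroup n ℂ) : Matrix n n ℂ) * star ((U ⟨q.src, q.ν⟩ : Matrix.specialUnitaryGroup n ℂ) : Matrix n n ℂ)
  set lin := (((U ⟨q.src, q.μ⟩ : Matrix.specialUnitaryGroup n ℂ) : Matrix n n ℂ) - 1) + (((U ⟨q.src.shift q.μ, q.ν⟩ : Matrix.specialUnitaryGroup n ℂ) : Matrix n n ℂ) - 1)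
        - (((U ⟨q.src.shift q.ν, q.μ⟩ : Matrix.specialUnitaryGroup n ℂ) : Matrix n n ℂ) - 1) - (((U ⟨q.src, q.ν⟩ : Matrix.specialUnitaryGroup n ℂ) : Matrix n n ℂ) - 1)
  have e : lin = (W - 1) - (W - 1 - lin) := by abel
  rw [e]
  exact (norm_sub_le _ _).trans (add_le_add le_rfl halg)

/-! ## §3 (69)_sym at the flat gauge: the rigid first-order sum read on the fine plaquettes -/

/-- **★★ (69)_sym AT THE FLAT GAUGE, `k`-UNIFORM**: for a finest-lattice `SU(n)` configuration with `‖U_b − 1‖ ≤ δ` everywhere (window of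
`EMLIterUniform.norm_iter_sub_one_sub_iterLin_le_uniform`, `2m_k ≤ 1`, `d + 2 ≤ L`), every `s ≤ k` and every plaquette `p = (y; μ, ν)` of `T^{(s)}`:
`dist1(Ū^{(s)}(∂p)) ≤ L^{−sd}·Σ_{x∈B^s(y)} Σ_{a,b<L^s} dist1 U(∂□₁(x + ae_μ + be_ν)) + (1296·L·(d+2)² + 65)·m_s²` — print's rigid sum of [Balaban1985UV3] (69) for the SYMMETRIC
average, with an explicit `k`-uniform second-order constant (`m_s = 2|n|²(d+1)L^sδ`).  Pieces: §2 (plaquette = `1 + curl Q^{(s)}Y + O(m_s²)`), p614177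
`curl_iterLinAvg_eq_rigidFlux` (the circulation of `Q^{(s)}Y` is the rigid sum of fine circulations of `Y = U − 1`), §2's fine reading `‖curl Y(q)‖ ≤ dist1 U(∂q) + 13δ²`
(`L^{2s}` such terms after the weight: `13L^{2s}δ² ≤ 13m_s²`). [cite: Balaban1985UV3, (69) p.273; Balaban1985Averaging, Prop. 4 (134)–(135) p.38, (42)–(43) p.24] -/
theorem dist1_plaqHol_iter_le_rigidSum
    (hL : P.d + 2 ≤ P.L) (U : GaugeField P 0 (Matrix.specialUnitaryGroup n ℂ)) {δ : ℝ} (hδ : 0 ≤ δ) (hδ1 : δ ≤ 1)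
    (hU : ∀ b, ‖((U b : Matrix.specialUnitaryGroup n ℂ) : Matrix n n ℂ) - 1‖ ≤ δ) (k : ℕ) (hk : k ≤ P.m + P.K)
    (hm : 324 * (P.L : ℝ) * ((P.d : ℝ) + 2) ^ 2 * (2 * (Fintype.card n : ℝ) ^ 2 * (((P.d : ℝ) + 1) * (P.L : ℝ) ^ k * δ)) ≤ 1)
    (hN : 4 * (((P.d + 2) * P.L : ℕ) : ℝ) * (2 * (Fintype.card n : ℝ) ^ 2 * (((P.d : ℝ) + 1) * (P.L : ℝ) ^ k * δ)) < deltaSU n)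
    (hm1 : 2 * (2 * (Fintype.card n : ℝ) ^ 2 * (((P.d : ℝ) + 1) * (P.L : ℝ) ^ k * δ)) ≤ 1)
    {s : ℕ} (hs : s ≤ k) (p : Plaq P s) :
    GaugeGroup.dist1 (GaugeField.plaqHol (Averaging.iter (fun i => blockAvg (P := P) (j := i) (expMeanLogSU (n := n))) s U) p) ≤
      (((P.L : ℝ) ^ s) ^ P.d)⁻¹ *
          ∑ x ∈ univ.filter (fun x : Site P 0 => Site.proj s s x = p.src), ∑ a ∈ range (P.L ^ s), ∑ b ∈ range (P.L ^ s),
            GaugeGroup.dist1 (GaugeField.plaqHol U ⟨runSite (runSite x p.μ a) p.ν b, p.μ, p.ν, p.hμν⟩) +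
        (1296 * (P.L : ℝ) * ((P.d : ℝ) + 2) ^ 2 + 65) * (2 * (Fintype.card n : ℝ) ^ 2 * (((P.d : ℝ) + 1) * (P.L : ℝ) ^ s * δ)) ^ 2 := by
  classical
  -- letters
  set Y : PBond P 0 → Matrix n n ℂ := fun b => ((U b : Matrix.specialUnitaryGroup n ℂ) : Matrix n n ℂ) - 1 with hY
  set m : ℝ := 2 * (Fintype.card n : ℝ) ^ 2 * (((P.d : ℝ) + 1) * (P.L : ℝ) ^ s * δ) with hmdef
  have hsk : s ≤ P.m + P.K := hs.trans hk
  have hL0 : (0 : ℝ) < P.L := Nat.cast_pos.mpr P.L_pos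
  have hLs : (0 : ℝ) < (P.L : ℝ) ^ s := pow_pos hL0 s
  -- the iterated linearised average as a family `Q`
  let Q : (i : ℕ) → (PBond P 0 → Matrix n n ℂ) → PBond P i → Matrix n n ℂ := fun i Z => Nat.rec (motive := fun i => PBond P i → Matrix n n ℂ) Z
    (fun i W c => linAvg W c) i
  have hQ0 : ∀ Z, Q 0 Z = Z := fun Z => rfl
  have hQs : ∀ (i : ℕ) (Z : PBond P 0 → Matrix n n ℂ) (c : PBond P (i + 1)), Q (i + 1) Z c = linAvg (Q i Z) c := fun i Z c => rfl
  -- §2: plaquette = 1 + curl(Q s Y) + O(m²)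
  have hplaq : ‖((GaugeField.plaqHol (Averaging.iter (fun i => blockAvg (P := P) (j := i) (expMeanLogSU (n := n))) s U) p :
        Matrix.specialUnitaryGroup n ℂ) : Matrix n n ℂ) - 1 - (Q s Y ⟨p.src, p.μ⟩ + Q s Y ⟨p.src.shift p.μ, p.ν⟩ - Q s Y ⟨p.src.shift p.ν, p.μ⟩ - Q s Y ⟨p.src, p.ν⟩)‖ ≤
      4 * (324 * (P.L : ℝ) * ((P.d : ℝ) + 2) ^ 2 * m ^ 2) + 52 * m ^ 2 :=
    norm_plaqHol_iter_sub_one_sub_curl_le Q hQ0 hQs hL U hδ hU k hm hN hm1 hs p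
  -- piece (i): the circulation of `Q s Y` is the rigid sum
  have hrig := curl_iterLinAvg_eq_rigidFlux Q hQ0 hQs hsk Y p.src p.μ p.ν
  -- the fine circulations read on the fine plaquettes
  have hshift : ∀ (z : Site P 0) (κ : Fin P.d), z.shift κ = runSite z κ 1 := fun z κ => by
    rw [show (1 : ℕ) = 0 + 1 from rfl, runSite_succ, runSite_zero]
  have hfine : ∀ (x : Site P 0) (a b : ℕ),
      ‖Y ⟨runSite (runSite x p.μ a) p.ν b, p.μ⟩ + Y ⟨runSite (runSite (runSite x p.μ a) p.ν b) p.μ 1, p.ν⟩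
          - Y ⟨runSite (runSite (runSite x p.μ a) p.ν b) p.ν 1, p.μ⟩ - Y ⟨runSite (runSite x p.μ a) p.ν b, p.ν⟩‖ ≤
        GaugeGroup.dist1 (GaugeField.plaqHol U ⟨runSite (runSite x p.μ a) p.ν b, p.μ, p.ν, p.hμν⟩) + 13 * δ ^ 2 := by
    intro x a b
    have h := norm_curl_sub_le_dist1_add U hδ hδ1 hU ⟨runSite (runSite x p.μ a) p.ν b, p.μ, p.ν, p.hμν⟩
    simp only [hshift] at h
    exact h
  -- norm of the rigid sum
  set S := ∑ x ∈ univ.filter (fun x : Site P 0 => Site.proj s s x = p.src), ∑ a ∈ range (P.L ^ s), ∑ b ∈ range (P.L ^ s),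
      (Y ⟨runSite (runSite x p.μ a) p.ν b, p.μ⟩ + Y ⟨runSite (runSite (runSite x p.μ a) p.ν b) p.μ 1, p.ν⟩
        - Y ⟨runSite (runSite (runSite x p.μ a) p.ν b) p.ν 1, p.μ⟩ - Y ⟨runSite (runSite x p.μ a) p.ν b, p.ν⟩) with hS
  set D := ∑ x ∈ univ.filter (fun x : Site P 0 => Site.proj s s x = p.src), ∑ a ∈ range (P.L ^ s), ∑ b ∈ range (P.L ^ s),
      GaugeGroup.dist1 (GaugeField.plaqHol U ⟨runSite (runSite x p.μ a) p.ν b, p.μ, p.ν, p.hμν⟩) with hD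
  have h0s : P.sitesPerDir 0 = P.L ^ s * P.sitesPerDir s := Prop7FlatCoercivity.sitesPerDir_zero_eq_pow_mul hsk
  have hcard : ∑ x ∈ univ.filter (fun x : Site P 0 => Site.proj s s x = p.src), ∑ a ∈ range (P.L ^ s), ∑ b ∈ range (P.L ^ s), (13 * δ ^ 2 : ℝ) =
      ((P.L : ℝ) ^ s) ^ P.d * ((P.L : ℝ) ^ s * ((P.L : ℝ) ^ s * (13 * δ ^ 2))) := by
    rw [Prop7FlatCoercivity.sum_fibre_eq_sum_offsets h0s]
    simp only [Finset.sum_const, Finset.card_range, Finset.card_univ, Fintype.card_pi, Fintype.card_fin, Finset.prod_const, nsmul_eq_mul]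
    push_cast
    ring
  have hSle : ‖S‖ ≤ D + ((P.L : ℝ) ^ s) ^ P.d * ((P.L : ℝ) ^ s * ((P.L : ℝ) ^ s * (13 * δ ^ 2))) := by
    rw [← hcard, hD, ← Finset.sum_add_distrib]
    refine (norm_sum_le _ _).trans (Finset.sum_le_sum fun x _ => ?_)
    rw [← Finset.sum_add_distrib]
    refine (norm_sum_le _ _).trans (Finset.sum_le_sum fun a _ => ?_)
    rw [← Finset.sum_add_distrib]
    exact (norm_sum_le _ _).trans (Finset.sum_le_sum fun b _ => hfine x a b)
  -- norm of the circulation of `Q s Y`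
  have hcurl : ‖Q s Y ⟨p.src, p.μ⟩ + Q s Y ⟨p.src.shift p.μ, p.ν⟩ - Q s Y ⟨p.src.shift p.ν, p.μ⟩ - Q s Y ⟨p.src, p.ν⟩‖ ≤
      (((P.L : ℝ) ^ s) ^ P.d)⁻¹ * D + 13 * ((P.L : ℝ) ^ s * δ) ^ 2 := by
    have hre : ∀ (r : ℝ) (M : Matrix n n ℂ), r • M = (r : ℂ) • M := fun r M => by
      rw [← Complex.coe_algebraMap]; exact (algebraMap_smul ℂ r M).symm
    rw [hrig, hre, norm_smul, norm_smul]
    have hn1 : ‖((P.L : ℕ) : ℂ) ^ s‖ = (P.L : ℝ) ^ s := by rw [norm_pow]; simp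
    have hn2 : ‖(((((P.L : ℝ) ^ s) ^ P.d * (P.L : ℝ) ^ s)⁻¹ : ℝ) : ℂ)‖ = (((P.L : ℝ) ^ s) ^ P.d * (P.L : ℝ) ^ s)⁻¹ := by
      rw [Complex.norm_real, Real.norm_eq_abs, abs_of_nonneg (by positivity)]
    rw [hn1, hn2]
    have hpos : 0 ≤ (P.L : ℝ) ^ s * (((P.L : ℝ) ^ s) ^ P.d * (P.L : ℝ) ^ s)⁻¹ := by positivity
    calc (P.L : ℝ) ^ s * ((((P.L : ℝ) ^ s) ^ P.d * (P.L : ℝ) ^ s)⁻¹ * ‖S‖)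
        = ((P.L : ℝ) ^ s * (((P.L : ℝ) ^ s) ^ P.d * (P.L : ℝ) ^ s)⁻¹) * ‖S‖ := by ring
      _ ≤ ((P.L : ℝ) ^ s * (((P.L : ℝ) ^ s) ^ P.d * (P.L : ℝ) ^ s)⁻¹) * (D + ((P.L : ℝ) ^ s) ^ P.d * ((P.L : ℝ) ^ s * ((P.L : ℝ) ^ s * (13 * δ ^ 2)))) :=
          mul_le_mul_of_nonneg_left hSle hpos
      _ = (((P.L : ℝ) ^ s) ^ P.d)⁻¹ * D + 13 * ((P.L : ℝ) ^ s * δ) ^ 2 := by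
          have hne1 : ((P.L : ℝ) ^ s) ^ P.d ≠ 0 := by positivity
          have hne2 : (P.L : ℝ) ^ s ≠ 0 := hLs.ne'
          field_simp
  -- `L^s δ ≤ m`
  have hLδ : (P.L : ℝ) ^ s * δ ≤ m := by
    rw [hmdef]
    have hcard1 : (1 : ℝ) ≤ (Fintype.card n : ℝ) := by exact_mod_cast Fintype.card_pos
    have hx : 0 ≤ (P.L : ℝ) ^ s * δ := by positivity
    have h1 : (1 : ℝ) ≤ 2 * (Fintype.card n : ℝ) ^ 2 * ((P.d : ℝ) + 1) := by
      have : (0 : ℝ) ≤ (P.d : ℝ) := Nat.cast_nonneg _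
      nlinarith
    calc (P.L : ℝ) ^ s * δ = 1 * ((P.L : ℝ) ^ s * δ) := (one_mul _).symm
      _ ≤ (2 * (Fintype.card n : ℝ) ^ 2 * ((P.d : ℝ) + 1)) * ((P.L : ℝ) ^ s * δ) := mul_le_mul_of_nonneg_right h1 hx
      _ = 2 * (Fintype.card n : ℝ) ^ 2 * (((P.d : ℝ) + 1) * (P.L : ℝ) ^ s * δ) := by ring
  have hLδ2 : ((P.L : ℝ) ^ s * δ) ^ 2 ≤ m ^ 2 := pow_le_pow_left₀ (by positivity) hLδ 2
  -- assemble: `dist1 = ‖plaq − 1‖ ≤ ‖curl‖ + ‖plaq − 1 − curl‖`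
  have hd : GaugeGroup.dist1 (GaugeField.plaqHol (Averaging.iter (fun i => blockAvg (P := P) (j := i) (expMeanLogSU (n := n))) s U) p) =
      ‖((GaugeField.plaqHol (Averaging.iter (fun i => blockAvg (P := P) (j := i) (expMeanLogSU (n := n))) s U) p : Matrix.specialUnitaryGroup n ℂ) :
        Matrix n n ℂ) - 1‖ := rfl
  rw [hd]
  have htri : ∀ (W C : Matrix n n ℂ), ‖W - 1‖ ≤ ‖C‖ + ‖W - 1 - C‖ := fun W C => by
    have e : W - 1 = C + (W - 1 - C) := by abel
    calc ‖W - 1‖ = ‖C + (W - 1 - C)‖ := by rw [← e]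
      _ ≤ ‖C‖ + ‖W - 1 - C‖ := norm_add_le _ _
  have hfinal : (((P.L : ℝ) ^ s) ^ P.d)⁻¹ * D + 13 * ((P.L : ℝ) ^ s * δ) ^ 2 +
      (4 * (324 * (P.L : ℝ) * ((P.d : ℝ) + 2) ^ 2 * m ^ 2) + 52 * m ^ 2) ≤
      (((P.L : ℝ) ^ s) ^ P.d)⁻¹ * D + (1296 * (P.L : ℝ) * ((P.d : ℝ) + 2) ^ 2 + 65) * m ^ 2 := by nlinarith
  exact ((htri _ (Q s Y ⟨p.src, p.μ⟩ + Q s Y ⟨p.src.shift p.μ, p.ν⟩ - Q s Y ⟨p.src.shift p.ν, p.μ⟩ - Q s Y ⟨p.src, p.ν⟩)).trans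
    (add_le_add hcurl hplaq)).trans hfinal

end Torus

end Summit.QuantumFields.YangMills.Theorems.EMLIterPlaqFirstOrder

end
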